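/-
Copyright (c) 2026 the pub-hodgecm-mathlib formalisation cell (harness21).  Prover seat hodgecm-mathlib-LH4-p11 (g7), req620 Track A «(D-RAM) FOUR-FRAME» squad, helper lane
on h413 = stmt-HodgeConjecture-24833 (count-neutral).  STAGE-1b brick (c2) of the seat's KNOCK 2026-09-04T08:24Z: central-rescaling invariance of unit U2G's PROFILE COUNTS.
2026-09-04.
-/
import Summits.HodgeConjecture.HodgeConjecture.Theorems.F0P3cDyRamFourFrameCensusDefs          -- ★ DEFS (U2G leaf, B-p08 (g41)): `LatticeInLevel`, `LatticeNearTransvShell`, `latticeValueSetMod`, `LatticeLabelPlus`, `transvPlusFixCount`, `transvMinusFixCount`, `regFixCount`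
import Literature.NumberTheory.Automorphic.UnitaryLatticeTreeCentralRescalingCountTransport  -- ★ (F0P3a-p05 (g17)): `mapGL_eq_of_coe_eq_smul`, `map_toLin'_le_scaleLattice_of_eq_smul_add_smul`, `scaleLattice_eq_self_of_v_eq_one`; brings ★ `mem_scaleLattice_iff`, `le_dualLatt_of_isVertexLattice`
import HarnessLib

/-!
# Crux `H413`, line LH4 «(D-RAM) FOUR-FRAME» — THE PROFILE COUNTS OF UNIT U2G ARE BLIND TO A CENTRAL RESCALING `T ↦ z·T` WITH `|z| = 1`, `|z − 1| ≤ |ϖ|^m`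
# (`transvPlusFixCount`, `transvMinusFixCount` at shell `(ℓ, m)`, `ℓ + 1 ≤ m`; `regFixCount` at level `m` — the piece analogue of ★ `fixedVertexCount_eq_of_coe_eq_smul`)

Cell `hodgecm-mathlib` (D-0151), FLOOR 0, crux item H413 = `stmt-HodgeConjecture-24833`, route of record `HCCMUnconditional`; squad F0∕P3c∕LH4 (req618∕req620); helper lane
`--supports stmt-HodgeConjecture-24833 --as helper` (count-neutral).  THEOREMS ONLY (no `def`, no instance, no notation, no `sorry`, default heartbeats); datum-free (`K` any
field with `Valued K ℤᵐ⁰`, any `σ`, `ϖ ≠ 0` with `|ϖ| ≤ 1`).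

WHY (STAGE-1b, the three open tier-0 rows `stub_rows_transvPlus ∕ transvMinus ∕ regular`).  Unit U2G's census dictionary ★ `PieceCountDictionary (gselStar j) (cntStar j)` (★ p854797)
reads the piece's orbital integral at a type-(1) literal `γ` as `νG₃(K) · cnt_j(ι_w γ)`, where the place matrix of the literal is `ι_w γ = z · Γ_b` — the FRAME ELEMENT `Γ_b =
frameElt σ_w f b α β` times a norm-one scalar `z = finGammaTwo γ_H` ((D-CΔ)-S).  The anchor count is blind to `z` outright (★ `fixedVertexCount_eq_of_coe_eq_smul`: a unit
homothety fixes every lattice), which is why the anchor laws (S)∕(K-ABS)∕(K-SGN) are typed on `Γ_b`.  The PROFILE counts are not blind to an arbitrary unit `z` — `z·Γ − 1 =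
z·(Γ − 1) + (z − 1)·1` shifts the element-minus-one by `(z − 1)·1` — but they ARE blind as soon as `|z − 1| ≤ |ϖ|^m` (`m` = the level the profile is read at, `m* = mstarFn` for
the pieces of record): THIS FILE.  So any piece law typed like U3's (on the frames `Γ_b`) transfers to the literals `ι_w t_b` of ★ `pieceRowsWild_of_signedCensus`'s H-side row
on the window `|finGammaTwo γ_H − 1| ≤ |ϖ|^{m*}` (a neighbourhood of `1`, to be intersected into the row's `V`).

THE MATHEMATICS ([Kottwitz1986, §1 pp. 240–241]; [Rogawski1990, §4.9 p. 55, Lemma 4.9.3 p. 56]; [BruhatTits1972, §10]: homotheties act trivially on the building; [Tits1979, §3.5]: congruence filtrations).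
Put `A := T − 1`, `B := z·T − 1 = z·A + (z − 1)·1` (and back: `A = z⁻¹·B + (z⁻¹ − 1)·1`, `|z⁻¹ − 1| = |z − 1|`).  Let `M` be a lattice with `T·M = M` (so `A·M ⊆ M`).
(i) `(z·T)·M = T·M` (★ `mapGL_eq_of_coe_eq_smul`).  (ii) LEVEL: `A·M ⊆ ϖ^ℓ M ⇔ B·M ⊆ ϖ^ℓ M` for `|z − 1| ≤ |ϖ|^ℓ` (★ `map_toLin'_le_scaleLattice_of_eq_smul_add_smul`, both ways).
(iii) SQUARE: `B² = z²A² + 2z(z − 1)A + (z − 1)²·1`, and `A·M ⊆ M`, so `A²·M ⊆ ϖ^m M ⇔ B²·M ⊆ ϖ^m M` for `|z − 1| ≤ |ϖ|^m`.  (iv) VALUE SET: for `y ∈ M`, `M` a vertex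
lattice (`M ⊆ M^♯`, so `|⟨y, y⟩| ≤ 1`, `|⟨y, Ay⟩| ≤ 1`): `⟨y, By⟩ = ⟨y, Ay⟩ + (z − 1)(⟨y, Ay⟩ + ⟨y, y⟩)` differs from `⟨y, Ay⟩` by an error of size `≤ |ϖ|^m`, so the value sets
thickened by `ϖ^m` coincide — hence the transvection LABEL (`latticeValueSetMod … = valueSetMod … (xPlus …)`) agrees.  (v) The three profile-count SETS `{M | type-0 vertex ∧ T·M = M
∧ profile}` therefore coincide for `T` and `z·T`, and so do their `ncard`s.

WHAT IS PROVED (§1 tokens at one lattice, §2 the counts).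
* §1 `latticeInLevel_iff_of_eq_smul` (ii) · `latticeInLevel_sq_iff_of_eq_smul` (iii) · `latticeValueSetMod_eq_of_eq_smul`, `latticeLabelPlus_iff_of_eq_smul` (iv) ·
  `latticeNearTransvShell_iff_of_eq_smul` · `sub_one_mulVec_mem_of_mapGL_eq` (`T·M = M ⇒ (T − 1)·M ⊆ M`); §0 algebra∕valuation helpers.
* §2 **`transvPlusFixCount_eq_of_coe_eq_smul`**, **`transvMinusFixCount_eq_of_coe_eq_smul`** (`ℓ + 1 ≤ m`, `|z| = 1`, `|z − 1| ≤ |ϖ|^m`), **`regFixCount_eq_of_coe_eq_smul`**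
  (`|z| = 1`, `|z − 1| ≤ |ϖ|^m`).
HONEST LABEL.  Count-neutral (`--supports`): lattice bookkeeping over a valued field; pays no registered stub, touches no `Lines/` module, states no census law; the three
tier-0 rows stay OPEN; `HC_CM` is proved only modulo the 7 printed citations (2 remaining named inputs: hLiu418 = `stmt-HodgeConjecture-24832`, h413 =
`stmt-HodgeConjecture-24833`) until rung 0 closes.

## References
* [Kottwitz1986BaseChangeUnits] R. E. Kottwitz, *Base change for unit elements of Hecke algebras*, Compositio Math. 60 (1986), §1 pp. 240–241 (the fixed-point formula; fixed lattices).
* [Rogawski1990] J. D. Rogawski, *Automorphic Representations of Unitary Groups in Three Variables*, Ann. of Math. Stud. 123 (1990), §4.9 Prop. 4.9.1 (b) p. 55, Lemma 4.9.3 p. 56.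
* [BruhatTits1972] F. Bruhat, J. Tits, *Groupes réductifs sur un corps local I*, Publ. Math. IHÉS 41 (1972), §10.
* [Tits1979] J. Tits, *Reductive groups over local fields*, PSPM 33.1 (1979), §3.5.
-/

set_option autoImplicit false

noncomputable section

namespace Summit.HodgeConjecture.HodgeConjecture.Cruxes.H413.F0P3cDyRamProfileCountCentralRescaling

open Literature.NumberTheory.Automorphic Literature.NumberTheory.Automorphic.UnitaryLatticeTree Literature.NumberTheory.Automorphic.HermitianLattice
open Summit.HodgeConjecture.HodgeConjecture.Cruxes.H413.F0P3cDyRamFourFrameCensusDefs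
open scoped Matrix MatrixGroups Valued WithZero

variable {K : Type*} [Field K] [Valued K ℤᵐ⁰]

/-! ## §0  Algebra of the central rescaling `B = z·A + (z − 1)·1` and two valuation helpers -/

omit [Valued K ℤᵐ⁰] in
/-- `z·T − 1 = z·(T − 1) + (z − 1)·1`. [cite: Kottwitz1986BaseChangeUnits, §1 pp. 240–241] -/
theorem smul_sub_one_eq (z : K) (T : Matrix (Fin 3) (Fin 3) K) :
    z • T - 1 = z • (T - 1) + (z - 1) • (1 : Matrix (Fin 3) (Fin 3) K) := by
  rw [smul_sub, sub_smul, one_smul]; abel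

omit [Valued K ℤᵐ⁰] in
/-- `T − 1 = z⁻¹·(z·T − 1) + (z⁻¹ − 1)·1` (`z ≠ 0`). [cite: Kottwitz1986BaseChangeUnits, §1 pp. 240–241] -/
theorem sub_one_eq_inv_smul (z : K) (hz : z ≠ 0) (T : Matrix (Fin 3) (Fin 3) K) :
    T - 1 = z⁻¹ • (z • T - 1) + (z⁻¹ - 1) • (1 : Matrix (Fin 3) (Fin 3) K) := by
  rw [smul_sub, smul_smul, inv_mul_cancel₀ hz, one_smul, sub_smul, one_smul]; abel

/-- Ultrametric bookkeeping: `|u − δ| ≤ 1 ↔ |u| ≤ 1` when `|δ| ≤ 1`. [cite: Tits1979, §3.5] -/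
theorem v_sub_le_one_iff_of_le {u δ : K} (hδ : Valued.v δ ≤ 1) : Valued.v (u - δ) ≤ 1 ↔ Valued.v u ≤ 1 := by
  constructor
  · intro h
    have h' := Valuation.map_add Valued.v (u - δ) δ
    rw [sub_add_cancel] at h'
    exact h'.trans (max_le h hδ)
  · intro h
    exact (Valuation.map_sub Valued.v u δ).trans (max_le h hδ)

/-- `a·y ∈ c·M` for `y ∈ M` and `|a| ≤ |c|` (`c ≠ 0`). [cite: BruhatTits1972, §10] -/
theorem smul_mem_scaleLattice_of_v_le {N : ℕ} {c a : K} (hc : c ≠ 0) (M : Submodule 𝒪[K] (Fin N → K)) {y : Fin N → K} (hy : y ∈ M)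
    (ha : Valued.v a ≤ Valued.v c) : a • y ∈ scaleLattice c M := by
  rw [mem_scaleLattice_iff hc, smul_smul]
  refine smul_mem_of_v_le M ?_ hy
  rw [map_mul, map_inv₀]
  have hvc : Valued.v c ≠ 0 := (Valuation.ne_zero_iff _).2 hc
  calc (Valued.v c)⁻¹ * Valued.v a ≤ (Valued.v c)⁻¹ * Valued.v c := mul_le_mul' le_rfl ha
    _ = 1 := inv_mul_cancel₀ hvc

/-! ## §1  The tokens at ONE lattice `M` -/

/-- `LatticeInLevel ϖ ℓ X M` read elementwise: `∀ x ∈ M, X·x ∈ ϖ^ℓ·M`. [cite: Kottwitz1986BaseChangeUnits, §1 pp. 240–241] -/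
theorem latticeInLevel_iff_forall (ϖ : K) (ℓ : ℕ) (X : Matrix (Fin 3) (Fin 3) K) (M : Submodule 𝒪[K] (Fin 3 → K)) :
    LatticeInLevel ϖ ℓ X M ↔ ∀ x ∈ M, X *ᵥ x ∈ scaleLattice (ϖ ^ ℓ) M := by
  rw [LatticeInLevel, Submodule.map_le_iff_le_comap]
  refine ⟨fun h x hx => ?_, fun h x hx => ?_⟩
  · have h' := h hx
    rwa [Submodule.mem_comap, LinearMap.restrictScalars_apply, Matrix.toLin'_apply] at h'
  · rw [Submodule.mem_comap, LinearMap.restrictScalars_apply, Matrix.toLin'_apply]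
    exact h x hx

/-- `T·M = M ⇒ (T − 1)·x ∈ M` for `x ∈ M`. [cite: Kottwitz1986BaseChangeUnits, §1 pp. 240–241] -/
theorem sub_one_mulVec_mem_of_mapGL_eq {T : GL (Fin 3) K} {M : Submodule 𝒪[K] (Fin 3 → K)} (hT : mapGL T M = M) {x : Fin 3 → K} (hx : x ∈ M) :
    ((T : Matrix (Fin 3) (Fin 3) K) - 1) *ᵥ x ∈ M := by
  rw [Matrix.sub_mulVec, Matrix.one_mulVec]
  refine Submodule.sub_mem _ ?_ hx
  have h1 : ((Matrix.toLin' (T : Matrix (Fin 3) (Fin 3) K)).restrictScalars 𝒪[K]) x ∈ mapGL T M := Submodule.mem_map_of_mem hx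
  rw [hT, LinearMap.restrictScalars_apply, Matrix.toLin'_apply] at h1
  exact h1

/-- (ii) THE LEVEL TOKEN: `LatticeInLevel ϖ ℓ (z·T − 1) M ↔ LatticeInLevel ϖ ℓ (T − 1) M` for `|z| = 1`, `|z − 1| ≤ |ϖ|^ℓ`. [cite: Kottwitz1986BaseChangeUnits, §1 pp. 240–241] [cite: Tits1979, §3.5] -/
theorem latticeInLevel_iff_of_eq_smul {ϖ : K} (hϖ : ϖ ≠ 0) {z : K} (hz1 : Valued.v z = 1) {ℓ : ℕ} (hzℓ : Valued.v (z - 1) ≤ Valued.v ϖ ^ ℓ)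
    {T T' : Matrix (Fin 3) (Fin 3) K} (hT' : T' = z • T) (M : Submodule 𝒪[K] (Fin 3 → K)) :
    LatticeInLevel ϖ ℓ (T' - 1) M ↔ LatticeInLevel ϖ ℓ (T - 1) M := by
  have hz : z ≠ 0 := fun h => by rw [h, map_zero] at hz1; exact zero_ne_one hz1
  have hc : ϖ ^ ℓ ≠ 0 := pow_ne_zero ℓ hϖ
  rw [← map_pow] at hzℓ
  constructor
  · intro h
    refine map_toLin'_le_scaleLattice_of_eq_smul_add_smul (A := T' - 1) (s := z⁻¹) (t := z⁻¹ - 1) ?_ ?_ hc ?_ M h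
    · rw [hT']; exact sub_one_eq_inv_smul z hz T
    · rw [map_inv₀, hz1, inv_one]
    · have hzi : Valued.v (z⁻¹ - 1) = Valued.v (z - 1) := by
        rw [show z⁻¹ - 1 = z⁻¹ * (1 - z) by rw [mul_sub, mul_one, inv_mul_cancel₀ hz], map_mul, map_inv₀, hz1, inv_one, one_mul,
          Valuation.map_sub_swap]
      rwa [hzi]
  · intro h
    exact map_toLin'_le_scaleLattice_of_eq_smul_add_smul (A := T - 1) (s := z) (t := z - 1) (by rw [hT']; exact smul_sub_one_eq z T) hz1.le hc hzℓ M h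

/-- (iii) one direction of the square token under `B = s·A + t·1`: `A·M ⊆ M`, `A²·M ⊆ c·M`, `|s| ≤ 1`, `|t| ≤ |c| ≤ 1` ⇒ `B²·M ⊆ c·M` (`B² x = s²A²x + st·Ax + ts·Ax + t²x`).
[cite: Kottwitz1986BaseChangeUnits, §1 pp. 240–241] [cite: Tits1979, §3.5] -/
theorem latticeInLevel_sq_of_eq_smul_add_smul {ϖ : K} (hϖ : ϖ ≠ 0) (hϖ1 : Valued.v ϖ ≤ 1) {m : ℕ} {A B : Matrix (Fin 3) (Fin 3) K} {s t : K}
    (hB : B = s • A + t • (1 : Matrix (Fin 3) (Fin 3) K)) (hs : Valued.v s ≤ 1) (ht : Valued.v t ≤ Valued.v ϖ ^ m) (M : Submodule 𝒪[K] (Fin 3 → K))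
    (hAM : ∀ x ∈ M, A *ᵥ x ∈ M) (h : LatticeInLevel ϖ m (A * A) M) : LatticeInLevel ϖ m (B * B) M := by
  have hc : ϖ ^ m ≠ 0 := pow_ne_zero m hϖ
  have hc1 : Valued.v (ϖ ^ m) ≤ 1 := by rw [map_pow]; exact pow_le_one' hϖ1 m
  rw [← map_pow] at ht
  rw [latticeInLevel_iff_forall] at h ⊢
  intro x hx
  have hBy : ∀ y, B *ᵥ y = s • (A *ᵥ y) + t • y := fun y => by
    rw [hB, Matrix.add_mulVec, Matrix.smul_mulVec, Matrix.smul_mulVec, Matrix.one_mulVec]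
  rw [← Matrix.mulVec_mulVec, hBy, hBy, Matrix.mulVec_add, Matrix.mulVec_smul, Matrix.mulVec_smul, smul_add, smul_add]
  have hAAx : A *ᵥ (A *ᵥ x) ∈ scaleLattice (ϖ ^ m) M := by rw [Matrix.mulVec_mulVec]; exact h x hx
  refine Submodule.add_mem _ (Submodule.add_mem _ ?_ ?_) (Submodule.add_mem _ ?_ ?_)
  · exact smul_mem_of_v_le _ hs (smul_mem_of_v_le _ hs hAAx)
  · rw [smul_smul]
    exact smul_mem_scaleLattice_of_v_le hc M (hAM x hx) (by rw [map_mul]; exact (mul_le_mul' hs ht).trans (by rw [one_mul]))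
  · rw [smul_smul]
    exact smul_mem_scaleLattice_of_v_le hc M (hAM x hx) (by rw [map_mul]; exact (mul_le_mul' ht hs).trans (by rw [mul_one]))
  · rw [smul_smul]
    exact smul_mem_scaleLattice_of_v_le hc M hx (by rw [map_mul]; exact (mul_le_mul' ht (ht.trans hc1)).trans (by rw [mul_one]))

/-- (iii) THE SQUARE TOKEN: `LatticeInLevel ϖ m ((z·T − 1)²) M ↔ LatticeInLevel ϖ m ((T − 1)²) M` for `T·M = M`-type lattices (`(T − 1)·M ⊆ M`), `|z| = 1`, `|z − 1| ≤ |ϖ|^m`.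
[cite: Kottwitz1986BaseChangeUnits, §1 pp. 240–241] [cite: Tits1979, §3.5] -/
theorem latticeInLevel_sq_iff_of_eq_smul {ϖ : K} (hϖ : ϖ ≠ 0) (hϖ1 : Valued.v ϖ ≤ 1) {z : K} (hz1 : Valued.v z = 1) {m : ℕ} (hzm : Valued.v (z - 1) ≤ Valued.v ϖ ^ m)
    {T T' : Matrix (Fin 3) (Fin 3) K} (hT' : T' = z • T) (M : Submodule 𝒪[K] (Fin 3 → K)) (hAM : ∀ x ∈ M, (T - 1) *ᵥ x ∈ M) :
    LatticeInLevel ϖ m ((T' - 1) * (T' - 1)) M ↔ LatticeInLevel ϖ m ((T - 1) * (T - 1)) M := by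
  have hz : z ≠ 0 := fun h => by rw [h, map_zero] at hz1; exact zero_ne_one hz1
  have hBM : ∀ x ∈ M, (T' - 1) *ᵥ x ∈ M := fun x hx => by
    rw [hT', smul_sub_one_eq, Matrix.add_mulVec, Matrix.smul_mulVec, Matrix.smul_mulVec, Matrix.one_mulVec]
    exact Submodule.add_mem _ (smul_mem_of_v_le _ hz1.le (hAM x hx))
      (smul_mem_of_v_le _ (hzm.trans (by rw [← map_pow, map_pow]; exact pow_le_one' hϖ1 m)) hx)
  constructor
  · intro h
    refine latticeInLevel_sq_of_eq_smul_add_smul hϖ hϖ1 (A := T' - 1) (s := z⁻¹) (t := z⁻¹ - 1) ?_ ?_ ?_ M hBM h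
    · rw [hT']; exact sub_one_eq_inv_smul z hz T
    · rw [map_inv₀, hz1, inv_one]
    · have hzi : Valued.v (z⁻¹ - 1) = Valued.v (z - 1) := by
        rw [show z⁻¹ - 1 = z⁻¹ * (1 - z) by rw [mul_sub, mul_one, inv_mul_cancel₀ hz], map_mul, map_inv₀, hz1, inv_one, one_mul,
          Valuation.map_sub_swap]
      rwa [hzi]
  · intro h
    exact latticeInLevel_sq_of_eq_smul_add_smul hϖ hϖ1 (A := T - 1) (s := z) (t := z - 1) (by rw [hT']; exact smul_sub_one_eq z T) hz1.le hzm M hAM h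

/-- `LatticeNearTransvShell ϖ ℓ m (z·T − 1) M ↔ LatticeNearTransvShell ϖ ℓ m (T − 1) M` (`ℓ + 1 ≤ m`, `|z| = 1`, `|z − 1| ≤ |ϖ|^m`, `(T − 1)·M ⊆ M`).
[cite: Kottwitz1986BaseChangeUnits, §1 pp. 240–241] [cite: Rogawski1990, §4.9 Prop. 4.9.1 (b) p. 55] -/
theorem latticeNearTransvShell_iff_of_eq_smul {ϖ : K} (hϖ : ϖ ≠ 0) (hϖ1 : Valued.v ϖ ≤ 1) {z : K} (hz1 : Valued.v z = 1) {ℓ m : ℕ} (hℓm : ℓ + 1 ≤ m)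
    (hzm : Valued.v (z - 1) ≤ Valued.v ϖ ^ m) {T T' : Matrix (Fin 3) (Fin 3) K} (hT' : T' = z • T) (M : Submodule 𝒪[K] (Fin 3 → K))
    (hAM : ∀ x ∈ M, (T - 1) *ᵥ x ∈ M) :
    LatticeNearTransvShell ϖ ℓ m (T' - 1) M ↔ LatticeNearTransvShell ϖ ℓ m (T - 1) M := by
  have hle : ∀ {n : ℕ}, n ≤ m → Valued.v (z - 1) ≤ Valued.v ϖ ^ n := fun hn => hzm.trans (pow_le_pow_right_of_le_one' hϖ1 hn)
  rw [LatticeNearTransvShell, LatticeNearTransvShell, latticeInLevel_iff_of_eq_smul hϖ hz1 (hle ((Nat.le_succ ℓ).trans hℓm)) hT' M,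
    latticeInLevel_iff_of_eq_smul hϖ hz1 (hle hℓm) hT' M, latticeInLevel_sq_iff_of_eq_smul hϖ hϖ1 hz1 hzm hT' M hAM]

/-- (iv) THE VALUE-SET TOKEN: on a vertex lattice `M` (`M ⊆ M^♯`) with `(T − 1)·M ⊆ M`, the value sets thickened by `ϖ^m` of `z·T − 1` and of `T − 1` coincide
(`|z| = 1`, `|z − 1| ≤ |ϖ|^m`): `⟨y, (z·T − 1)y⟩ = ⟨y, (T − 1)y⟩ + (z − 1)(⟨y, (T − 1)y⟩ + ⟨y, y⟩)`, an error of size `≤ |ϖ|^m`.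
[cite: Rogawski1990, §4.9 Prop. 4.9.1 (b) p. 55, Lemma 4.9.3 p. 56] [cite: Kottwitz1986BaseChangeUnits, §1 pp. 240–241] -/
theorem latticeValueSetMod_eq_of_eq_smul {σ : K →+* K} (hvσ : ∀ a, Valued.v (σ a) = Valued.v a) {ϖ : K} (hϖ : ϖ ≠ 0)
    {z : K} {m : ℕ} (hzm : Valued.v (z - 1) ≤ Valued.v ϖ ^ m) {d : ℕ} {M : Submodule 𝒪[K] (Fin 3 → K)}
    (hM : IsVertexLattice σ ϖ ((StdForm.antidiagonal 3).over K) d M) {T T' : Matrix (Fin 3) (Fin 3) K} (hT' : T' = z • T)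
    (hAM : ∀ x ∈ M, (T - 1) *ᵥ x ∈ M) :
    latticeValueSetMod σ ϖ m M (T' - 1) = latticeValueSetMod σ ϖ m M (T - 1) := by
  have hc : ϖ ^ m ≠ 0 := pow_ne_zero m hϖ
  have hvc : Valued.v (ϖ ^ m) ≠ 0 := (Valuation.ne_zero_iff _).2 hc
  rw [← map_pow] at hzm
  ext w
  simp only [latticeValueSetMod, Set.mem_setOf_eq]
  refine exists_congr fun y => and_congr_right fun hy => ?_
  -- the two pairings differ by `e := (z − 1)(⟨y, (T − 1)y⟩ + ⟨y, y⟩)`, `|e| ≤ |ϖ^m|`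
  have hdual := le_dualLatt_of_isVertexLattice hvσ hM
  have ha : Valued.v (pairing σ ((StdForm.antidiagonal 3).over K) y ((T - 1) *ᵥ y)) ≤ 1 :=
    (mem_dualLatt σ _ M _).1 (hdual (hAM y hy)) y hy
  have hb : Valued.v (pairing σ ((StdForm.antidiagonal 3).over K) y y) ≤ 1 := (mem_dualLatt σ _ M _).1 (hdual hy) y hy
  have key : pairing σ ((StdForm.antidiagonal 3).over K) y ((T' - 1) *ᵥ y) =
      pairing σ ((StdForm.antidiagonal 3).over K) y ((T - 1) *ᵥ y) +
        (z - 1) * (pairing σ ((StdForm.antidiagonal 3).over K) y ((T - 1) *ᵥ y) + pairing σ ((StdForm.antidiagonal 3).over K) y y) := by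
    rw [hT', smul_sub_one_eq, Matrix.add_mulVec, Matrix.smul_mulVec, Matrix.smul_mulVec, Matrix.one_mulVec, map_add, map_smul, map_smul,
      smul_eq_mul, smul_eq_mul]
    ring
  have he : Valued.v ((ϖ ^ m)⁻¹ * ((z - 1) * (pairing σ ((StdForm.antidiagonal 3).over K) y ((T - 1) *ᵥ y) + pairing σ ((StdForm.antidiagonal 3).over K) y y))) ≤ 1 := by
    rw [map_mul, map_mul, map_inv₀]
    have hsum : Valued.v (pairing σ ((StdForm.antidiagonal 3).over K) y ((T - 1) *ᵥ y) + pairing σ ((StdForm.antidiagonal 3).over K) y y) ≤ 1 :=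
      (Valuation.map_add Valued.v _ _).trans (max_le ha hb)
    calc (Valued.v (ϖ ^ m))⁻¹ * (Valued.v (z - 1) * Valued.v _)
        ≤ (Valued.v (ϖ ^ m))⁻¹ * (Valued.v (ϖ ^ m) * 1) := mul_le_mul' le_rfl (mul_le_mul' hzm hsum)
      _ = 1 := by rw [mul_one, inv_mul_cancel₀ hvc]
  have hsplit : (ϖ ^ m)⁻¹ * (w - pairing σ ((StdForm.antidiagonal 3).over K) y ((T' - 1) *ᵥ y)) =
      (ϖ ^ m)⁻¹ * (w - pairing σ ((StdForm.antidiagonal 3).over K) y ((T - 1) *ᵥ y)) -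
        (ϖ ^ m)⁻¹ * ((z - 1) * (pairing σ ((StdForm.antidiagonal 3).over K) y ((T - 1) *ᵥ y) + pairing σ ((StdForm.antidiagonal 3).over K) y y)) := by
    rw [key]; ring
  rw [hsplit, v_sub_le_one_iff_of_le he]

/-- (iv′) THE LABEL TOKEN: `LatticeLabelPlus σ ϖ d m M (z·T − 1) ↔ LatticeLabelPlus σ ϖ d m M (T − 1)` (same hypotheses; any reference depth `d`).
[cite: Rogawski1990, §4.9 Prop. 4.9.1 (b) p. 55] [cite: Kottwitz1986BaseChangeUnits, §1 pp. 240–241] -/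
theorem latticeLabelPlus_iff_of_eq_smul {σ : K →+* K} (hvσ : ∀ a, Valued.v (σ a) = Valued.v a) {ϖ : K} (hϖ : ϖ ≠ 0)
    {z : K} {m : ℕ} (hzm : Valued.v (z - 1) ≤ Valued.v ϖ ^ m) {dv : ℕ} {M : Submodule 𝒪[K] (Fin 3 → K)}
    (hM : IsVertexLattice σ ϖ ((StdForm.antidiagonal 3).over K) dv M) {T T' : Matrix (Fin 3) (Fin 3) K} (hT' : T' = z • T)
    (hAM : ∀ x ∈ M, (T - 1) *ᵥ x ∈ M) (d : ℕ) :
    LatticeLabelPlus σ ϖ d m M (T' - 1) ↔ LatticeLabelPlus σ ϖ d m M (T - 1) := by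
  rw [LatticeLabelPlus, LatticeLabelPlus, latticeValueSetMod_eq_of_eq_smul hvσ hϖ hzm hM hT' hAM]

/-! ## §2  The three profile counts -/

/-- **`transvPlusFixCount` IS BLIND TO A UNIT CENTRAL RESCALING CONGRUENT TO `1` MOD `ϖ^m`**: `(T' : Matrix) = z·T`, `|z| = 1`, `|z − 1| ≤ |ϖ|^m`, `ℓ + 1 ≤ m` ⇒
`transvPlusFixCount σ ϖ d ℓ m T' = transvPlusFixCount σ ϖ d ℓ m T` (the fixed type-0 vertices agree by ★ `mapGL_eq_of_coe_eq_smul`; at each of them the shell and the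
label agree by §1). [cite: Kottwitz1986BaseChangeUnits, §1 pp. 240–241] [cite: Rogawski1990, §4.9 Prop. 4.9.1 (b) p. 55] -/
theorem transvPlusFixCount_eq_of_coe_eq_smul {σ : K →+* K} (hvσ : ∀ a, Valued.v (σ a) = Valued.v a) {ϖ : K} (hϖ : ϖ ≠ 0) (hϖ1 : Valued.v ϖ ≤ 1)
    {z : K} (hz1 : Valued.v z = 1) (d : ℕ) {ℓ m : ℕ} (hℓm : ℓ + 1 ≤ m) (hzm : Valued.v (z - 1) ≤ Valued.v ϖ ^ m)
    {T T' : GL (Fin 3) K} (hT' : (T' : Matrix (Fin 3) (Fin 3) K) = z • (T : Matrix (Fin 3) (Fin 3) K)) :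
    transvPlusFixCount σ ϖ d ℓ m T' = transvPlusFixCount σ ϖ d ℓ m T := by
  unfold transvPlusFixCount
  congr 1
  ext M
  simp only [Set.mem_setOf_eq]
  refine and_congr_right fun hM => ?_
  rw [mapGL_eq_of_coe_eq_smul hz1 hT' M]
  refine and_congr_right fun hfix => ?_
  have hAM : ∀ x ∈ M, ((T : Matrix (Fin 3) (Fin 3) K) - 1) *ᵥ x ∈ M := fun x hx => sub_one_mulVec_mem_of_mapGL_eq hfix hx
  rw [latticeNearTransvShell_iff_of_eq_smul hϖ hϖ1 hz1 hℓm hzm hT' M hAM, latticeLabelPlus_iff_of_eq_smul hvσ hϖ hzm hM hT' hAM d]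

/-- **`transvMinusFixCount` IS BLIND TO THE SAME RESCALING** (label negated). [cite: Kottwitz1986BaseChangeUnits, §1 pp. 240–241] [cite: Rogawski1990, §4.9 Prop. 4.9.1 (b) p. 55] -/
theorem transvMinusFixCount_eq_of_coe_eq_smul {σ : K →+* K} (hvσ : ∀ a, Valued.v (σ a) = Valued.v a) {ϖ : K} (hϖ : ϖ ≠ 0) (hϖ1 : Valued.v ϖ ≤ 1)
    {z : K} (hz1 : Valued.v z = 1) (d : ℕ) {ℓ m : ℕ} (hℓm : ℓ + 1 ≤ m) (hzm : Valued.v (z - 1) ≤ Valued.v ϖ ^ m)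
    {T T' : GL (Fin 3) K} (hT' : (T' : Matrix (Fin 3) (Fin 3) K) = z • (T : Matrix (Fin 3) (Fin 3) K)) :
    transvMinusFixCount σ ϖ d ℓ m T' = transvMinusFixCount σ ϖ d ℓ m T := by
  unfold transvMinusFixCount
  congr 1
  ext M
  simp only [Set.mem_setOf_eq]
  refine and_congr_right fun hM => ?_
  rw [mapGL_eq_of_coe_eq_smul hz1 hT' M]
  refine and_congr_right fun hfix => ?_
  have hAM : ∀ x ∈ M, ((T : Matrix (Fin 3) (Fin 3) K) - 1) *ᵥ x ∈ M := fun x hx => sub_one_mulVec_mem_of_mapGL_eq hfix hx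
  rw [latticeNearTransvShell_iff_of_eq_smul hϖ hϖ1 hz1 hℓm hzm hT' M hAM, latticeLabelPlus_iff_of_eq_smul hvσ hϖ hzm hM hT' hAM d]

/-- **`regFixCount` IS BLIND TO THE SAME RESCALING** (`|z| = 1`, `|z − 1| ≤ |ϖ|^m`; no `σ`-hypothesis needed — only the square token enters).
[cite: Kottwitz1986BaseChangeUnits, §1 pp. 240–241] [cite: Rogawski1990, §4.9 Prop. 4.9.1 (b) p. 55] -/
theorem regFixCount_eq_of_coe_eq_smul (σ : K →+* K) {ϖ : K} (hϖ : ϖ ≠ 0) (hϖ1 : Valued.v ϖ ≤ 1) {z : K} (hz1 : Valued.v z = 1) {m : ℕ}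
    (hzm : Valued.v (z - 1) ≤ Valued.v ϖ ^ m) {T T' : GL (Fin 3) K} (hT' : (T' : Matrix (Fin 3) (Fin 3) K) = z • (T : Matrix (Fin 3) (Fin 3) K)) :
    regFixCount σ ϖ m T' = regFixCount σ ϖ m T := by
  unfold regFixCount
  congr 1
  ext M
  simp only [Set.mem_setOf_eq]
  refine and_congr_right fun _hM => ?_
  rw [mapGL_eq_of_coe_eq_smul hz1 hT' M]
  refine and_congr_right fun hfix => ?_
  have hAM : ∀ x ∈ M, ((T : Matrix (Fin 3) (Fin 3) K) - 1) *ᵥ x ∈ M := fun x hx => sub_one_mulVec_mem_of_mapGL_eq hfix hx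
  rw [latticeInLevel_sq_iff_of_eq_smul hϖ hϖ1 hz1 hzm hT' M hAM]

end Summit.HodgeConjecture.HodgeConjecture.Cruxes.H413.F0P3cDyRamProfileCountCentralRescaling

end
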